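import Literature.MathematicalPhysics.QuantumLattice.HyperoctahedralFockAction
import Mathlib.Tactic.NoncommRing
import HarnessLib

/-!
# The transposition formula for the graded hyperoctahedral Fock action:
# `π((x y)) = ∏_σ [1 - (c†_{xσ} - c†_{yσ})(c_{xσ} - c_{yσ})]`

Topic `Literature/MathematicalPhysics/QuantumLattice`; follow-up to
`HyperoctahedralFockAction.lean` (definition request `defn-GradedHyperoctahedralFockAction`, "API
wanted: the transposition formula … this is the inline `Sw x y` of the route's cruxes
FatHookPairConcavity / FatHookSpinOrder / CompleteGraphAnchor / SusyInterchangeIdentity — the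
definition should be proved equal to it so those items can be restated through `π`").

Everything is PROVED. For two distinct orbitals `p ≠ q` the EXCHANGE OPERATOR
`exchange p q = 1 - (c†_p - c†_q)(c_p - c_q) = 1 - n_p - n_q + c†_p c_q + c†_q c_p`
(Dirac's exchange operator for one fermion species restricted to the two modes) satisfies, by the
canonical anticommutation relations (tree: `annihilation_mul_creation`,
`creation_mul_creation_eq_neg`, `creation_mul_self`):
`exchange p q · c†_p = c†_q · exchange p q` (`exchange_mul_creation_left`), the same with `p, q`
swapped, and `exchange p q` commutes with `c†_r` for `r ∉ {p, q}`; it fixes the vacuum. Hence the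
site exchange `siteSwap x y = exchange (x↑) (y↑) · exchange (x↓) (y↓)` intertwines every `c†_i`
with `c†_{(x y) i}` and fixes the vacuum, and the uniqueness principle
`eq_one_of_commute_creation_of_mulVec_vacuum` identifies it with `π((x y))`:

* `gradedHyperoctahedralFockAction_swap` —
  `π(inr (swap x y)) = siteSwap x y = ∏_σ [1 - (c†_{xσ} - c†_{yσ})(c_{xσ} - c_{yσ})]` for `x ≠ y`.

## References
* P. A. M. Dirac, Proc. R. Soc. A 123 (1929) 714 (the exchange operator as a permutation);
  O. Bratteli, D. W. Robinson, *Operator Algebras and QSM II* (1997), §5.2.2 (CAR, Fock space).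
  [BratteliRobinsonII1997]
-/

noncomputable section

namespace Literature.MathematicalPhysics.QuantumLattice

open Matrix Finset HubbardWave0

/-! ### The two-mode exchange operator and the CAR computations -/

section Exchange

variable {ι : Type*} [LinearOrder ι] [Fintype ι]

/-- The **exchange operator** of two orbitals: `1 - (c†_p - c†_q)(c_p - c_q)`. [folklore] -/
def exchange (p q : ι) : Matrix (Finset ι) (Finset ι) ℂ :=
  1 - (creation p - creation q) * (annihilation p - annihilation q)

omit [Fintype ι] in
/-- The exchange operator is symmetric in the two orbitals. [folklore] -/
theorem exchange_comm [Fintype ι] (p q : ι) : exchange p q = exchange q p := by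
  unfold exchange
  noncomm_ring

/-- **`E · c†_p = c†_q · E`** for `E = exchange p q`, `p ≠ q` (CAR computation: both sides equal
`c†_q - c†_q c†_p c_p + c†_q c†_p c_q`). [folklore] -/
theorem exchange_mul_creation_left {p q : ι} (hpq : p ≠ q) :
    exchange p q * creation p = creation q * exchange p q := by
  set A := creation p
  set B := creation q
  set a := annihilation p
  set b := annihilation q
  have h1 : a * A = 1 - A * a := by
    simp [A, a, annihilation_mul_creation]
  have h2 : b * A = -(A * b) := by
    simp only [A, b, annihilation_mul_creation, if_neg (Ne.symm hpq), zero_sub]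
  have h3 : A * A = 0 := creation_mul_self p
  have h4 : B * B = 0 := creation_mul_self q
  have lhs : exchange p q * A = B - B * A * a + B * A * b := by
    have e1 : exchange p q * A = A - (A - B) * (a * A - b * A) := by
      unfold exchange; noncomm_ring
    rw [e1, h1, h2]
    have e2 : A - (A - B) * (1 - A * a - -(A * b)) =
        B + A * A * a - A * A * b - B * A * a + B * A * b := by noncomm_ring
    rw [e2, h3]
    noncomm_ring
  have rhs : B * exchange p q = B - B * A * a + B * A * b := by
    have e1 : B * exchange p q = B - B * A * a + B * A * b + B * B * a - B * B * b := by
      unfold exchange; noncomm_ring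
    rw [e1, h4]
    noncomm_ring
  rw [lhs, rhs]

/-- `E · c†_q = c†_p · E`. [folklore] -/
theorem exchange_mul_creation_right {p q : ι} (hpq : p ≠ q) :
    exchange p q * creation q = creation p * exchange p q := by
  rw [exchange_comm]
  exact exchange_mul_creation_left (Ne.symm hpq)

/-- The exchange operator commutes with the creation operators of the other orbitals.
[folklore] -/
theorem exchange_mul_creation_of_ne {p q r : ι} (hrp : r ≠ p) (hrq : r ≠ q) :
    exchange p q * creation r = creation r * exchange p q := by
  set A := creation p
  set B := creation q
  set a := annihilation p
  set b := annihilation q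
  set C := creation r
  have ha : a * C = -(C * a) := by
    simp only [a, C, annihilation_mul_creation, if_neg (Ne.symm hrp), zero_sub]
  have hb : b * C = -(C * b) := by
    simp only [b, C, annihilation_mul_creation, if_neg (Ne.symm hrq), zero_sub]
  have hA : A * C = -(C * A) := creation_mul_creation_eq_neg p r
  have hB : B * C = -(C * B) := creation_mul_creation_eq_neg q r
  have e1 : exchange p q * C = C - (A - B) * (a * C - b * C) := by
    unfold exchange; noncomm_ring
  have e2 : C * exchange p q = C - C * (A - B) * (a - b) := by
    unfold exchange; noncomm_ring
  rw [e1, e2, ha, hb]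
  have e3 : (A - B) * (-(C * a) - -(C * b)) = -((A * C - B * C) * (a - b)) := by noncomm_ring
  rw [e3, hA, hB]
  noncomm_ring

/-- The exchange operator fixes the vacuum. [folklore] -/
theorem exchange_mulVec_vacuum (p q : ι) : exchange p q *ᵥ (vacuum : Fock ι) = vacuum := by
  have h0 : ∀ i : ι, annihilation i *ᵥ (vacuum : Fock ι) = 0 := fun i => by
    rw [vacuum, annihilation_mulVec_single, if_neg (Finset.notMem_empty i)]
  have hk : (annihilation p - annihilation q) *ᵥ (vacuum : Fock ι) = 0 := by
    rw [sub_mulVec, h0, h0, sub_zero]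
  rw [exchange, sub_mulVec, one_mulVec, ← mulVec_mulVec, hk, mulVec_zero, sub_zero]

end Exchange

/-! ### The site exchange and the transposition formula -/

section SiteSwap

variable {Λ : Type*} [LinearOrder Λ] [Fintype Λ]

/-- **The site exchange operator** `Sw x y = ∏_σ [1 - (c†_{xσ} - c†_{yσ})(c_{xσ} - c_{yσ})]`
(product over the two spin values, written as `σ = 0` times `σ = 1`; the factors commute), the
inline `Sw x y` of route HubbardSuperconductivity/HyperoctahedralMott. [folklore] -/
def siteSwap (x y : Λ) : Matrix (Finset (Orb Λ)) (Finset (Orb Λ)) ℂ :=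
  exchange (orb x 0) (orb y 0) * exchange (orb x 1) (orb y 1)

/-- **The site exchange intertwines the creation operators with the transposition**:
`Sw c†_i = c†_{(x y) i} Sw` for every orbital `i`. [folklore] -/
theorem siteSwap_mul_creation {x y : Λ} (hxy : x ≠ y) (i : Orb Λ) :
    siteSwap x y * creation i = creation (Orb.mapEquiv (Equiv.swap x y) i) * siteSwap x y := by
  -- distinct sites / spins give distinct orbitals (cf. `EtaPairingODLRO.orb_ne_orb_of_ne`)
  have orb_ne_orb_of_ne : ∀ {u v : Λ}, u ≠ v → ∀ σ τ : Fin 2, orb u σ ≠ orb v τ :=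
    fun h σ τ h' => h (congrArg (fun i : Orb Λ => (ofLex i).1) h')
  have orb_ne_orb_of_ne_spin : ∀ (u v : Λ) {σ τ : Fin 2}, σ ≠ τ → orb u σ ≠ orb v τ :=
    fun u v σ τ h h' => h (congrArg (fun i : Orb Λ => (ofLex i).2) h')
  -- write `i = orb z τ`
  obtain ⟨z, τ⟩ := i
  show siteSwap x y * creation (orb z τ) =
    creation (orb (Equiv.swap x y z) τ) * siteSwap x y
  unfold siteSwap
  by_cases hzx : z = x
  · subst hzx
    rw [Equiv.swap_apply_left]
    rcases Fin.exists_fin_two.1 ⟨τ, rfl⟩ with h0 | h1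
    · rw [h0, mul_assoc,
        exchange_mul_creation_of_ne (orb_ne_orb_of_ne_spin z z Fin.zero_ne_one)
          (orb_ne_orb_of_ne_spin z y Fin.zero_ne_one),
        ← mul_assoc, exchange_mul_creation_left (orb_ne_orb_of_ne hxy 0 0), mul_assoc]
    · rw [h1, mul_assoc, exchange_mul_creation_left (orb_ne_orb_of_ne hxy 1 1), ← mul_assoc,
        exchange_mul_creation_of_ne (orb_ne_orb_of_ne (Ne.symm hxy) 1 0)
          (orb_ne_orb_of_ne_spin y y (Ne.symm Fin.zero_ne_one)),
        mul_assoc]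
  by_cases hzy : z = y
  · subst hzy
    rw [Equiv.swap_apply_right]
    rcases Fin.exists_fin_two.1 ⟨τ, rfl⟩ with h0 | h1
    · rw [h0, mul_assoc,
        exchange_mul_creation_of_ne (orb_ne_orb_of_ne_spin z x Fin.zero_ne_one)
          (orb_ne_orb_of_ne_spin z z Fin.zero_ne_one),
        ← mul_assoc, exchange_mul_creation_right (orb_ne_orb_of_ne hxy 0 0), mul_assoc]
    · rw [h1, mul_assoc, exchange_mul_creation_right (orb_ne_orb_of_ne hxy 1 1), ← mul_assoc,
        exchange_mul_creation_of_ne (orb_ne_orb_of_ne_spin x x (Ne.symm Fin.zero_ne_one))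
          (orb_ne_orb_of_ne hxy 1 0),
        mul_assoc]
  · rw [Equiv.swap_apply_of_ne_of_ne hzx hzy, mul_assoc,
      exchange_mul_creation_of_ne (orb_ne_orb_of_ne hzx τ 1) (orb_ne_orb_of_ne hzy τ 1),
      ← mul_assoc,
      exchange_mul_creation_of_ne (orb_ne_orb_of_ne hzx τ 0) (orb_ne_orb_of_ne hzy τ 0),
      mul_assoc]

/-- The site exchange fixes the vacuum. [folklore] -/
theorem siteSwap_mulVec_vacuum (x y : Λ) : siteSwap x y *ᵥ (vacuum : Fock (Orb Λ)) = vacuum := by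
  rw [siteSwap, ← mulVec_mulVec, exchange_mulVec_vacuum, exchange_mulVec_vacuum]

/-- **The transposition formula**: for `x ≠ y`, the graded Fock action of the transposition
`(x y)` IS the site exchange operator,
`π(inr (swap x y)) = ∏_σ [1 - (c†_{xσ} - c†_{yσ})(c_{xσ} - c_{yσ})]`. Proof: `Γᴴ · Sw` commutes with
every `c†_i` and fixes the vacuum, hence is `1` (`eq_one_of_commute_creation_of_mulVec_vacuum`).
[folklore] -/
theorem gradedHyperoctahedralFockAction_swap {x y : Λ} (hxy : x ≠ y) :
    (gradedHyperoctahedralFockAction (SemidirectProduct.inr (Equiv.swap x y))).val = siteSwap x y := by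
  rw [gradedHyperoctahedralFockAction_inr]
  set e := Orb.mapEquiv (Equiv.swap x y) with he
  set Γ := relabelMatrix e with hΓ
  have hΓΓ : Γ * Γᴴ = 1 := relabelMatrix_mul_conjTranspose e
  have hΓΓ' : Γᴴ * Γ = 1 := conjTranspose_mul_relabelMatrix e
  -- `Γᴴ c†_{e i} = c†_i Γᴴ`
  have hconj : ∀ i, Γᴴ * creation (e i) = creation i * Γᴴ := by
    intro i
    have h := relabelMatrix_mul_creation_mul_conjTranspose e i
    rw [← hΓ] at h
    calc Γᴴ * creation (e i) = Γᴴ * (Γ * creation i * Γᴴ) := by rw [h]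
      _ = (Γᴴ * Γ) * creation i * Γᴴ := by simp only [Matrix.mul_assoc]
      _ = creation i * Γᴴ := by rw [hΓΓ', Matrix.one_mul]
  have hV : Γᴴ * siteSwap x y = 1 := by
    refine eq_one_of_commute_creation_of_mulVec_vacuum _ (fun i => ?_) ?_
    · rw [Matrix.mul_assoc, siteSwap_mul_creation hxy, ← Matrix.mul_assoc, hconj,
        Matrix.mul_assoc]
    · rw [← mulVec_mulVec, siteSwap_mulVec_vacuum]
      have hv := relabelMatrix_mulVec_vacuum e
      rw [← hΓ] at hv
      calc Γᴴ *ᵥ (vacuum : Fock (Orb Λ)) = Γᴴ *ᵥ (Γ *ᵥ vacuum) := by rw [hv]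
        _ = (Γᴴ * Γ) *ᵥ vacuum := by rw [mulVec_mulVec]
        _ = vacuum := by rw [hΓΓ', one_mulVec]
  calc Γ = Γ * (Γᴴ * siteSwap x y) := by rw [hV, Matrix.mul_one]
    _ = (Γ * Γᴴ) * siteSwap x y := by rw [Matrix.mul_assoc]
    _ = siteSwap x y := by rw [hΓΓ, Matrix.one_mul]

end SiteSwap

end Literature.MathematicalPhysics.QuantumLattice
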